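import Literature.Computability.AlgebraicComplexity.Yab15BRank
import HarnessLib

/-!
# Yabe 2015, §3: the inertia of the real Hessian is bounded by the bi-polynomial rank

Typed-and-PROVED literature (val-lit cell, seat t10; lead-lmr ruling 2026-08-26T03:55Z: «Yabe's
printed §3 chain `brank((p_{x₀})^{(2)}) ≥ n₋`, a genuine statement nobody else has»): A. Yabe,
*Bi-polynomial rank and determinantal complexity*, arXiv:1504.00151 (2015), §3.1–§3.2, held text
`paper:arxiv-1504.00151` chunk p0008 (the store's title metadata for that key is wrong; the text is
Yabe's). Honest framing: bookkeeping of a published argument; `VP ≠ VNP` is NOT proved and nothing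
here is progress on it. Everything in this file is a theorem; no named fact is introduced.

In the proof of Thm. 1.7 (p0008) Yabe argues: a decomposition of the quadratic part
`p_{x₀}^{(2)} = Σ_{m ≤ n} (Σ_l b^m_l x_l)(Σ_l c^m_l x_l)` gives `A := Σ_m b^m (c^m)ᵀ` with
`A + Aᵀ = H_{p,x₀}` and `rank A ≤ n`; "by Theorem 2.1, `brank = rank(Q_opt)`; since
`Q_opt + Q_optᵀ = H` by Lemma 3.1 it follows that `rank(Q_opt) ≥ n₋`. Therefore …
`brank(p_{x₀}^{(2)}) ≥ n₋`."  This file proves the conclusion for every real polynomial and point,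
in the two-sided form `max(n₊, n₋)(H_{p,x₀}) ≤ brank((p_{x₀})^{(2)})`
(`Yabe.max_card_eigenvalues_hessian_le_bRank`, `Yabe.card_eigenvalues_hessian_neg_le_bRank`),
directly from an optimal decomposition (`exists_eq_sum_mul_of_isHomogeneous`,
`hess0_mul_of_isHomogeneous_one`, `Yab15BRank.lean`) and Lemma 3.1 (`yabe2015_lemma_3_1_holds`)
applied to `A` — Thm. 2.1 is not needed.  It complements the tree's direct engine
`yabe2015_signature_le_determinantalComplexity` (`max(n₊, n₋) ≤ dc` at a zero, `Yab15BRank.lean`,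
seat t17), which bypasses `brank`; together with Thm. 1.5 at `k = 1` (`brank ≤ dc`) the present
statement is the printed route to Thm. 1.7 (whose discharge is seat t17's `Yab15BRankRealBound.lean`).

## References

* A. Yabe, arXiv:1504.00151, §3.1–§3.2, chunk p0008 L40–L110 (key `Yabe2015`).
-/

noncomputable section

open MvPolynomial Matrix Finset

namespace Literature.Computability.AlgebraicComplexity

namespace Yabe

/-! ### Glue: the negative index of the Hessian is at most the bi-polynomial rank -/

section Glue

variable {σ : Type*} [Fintype σ] [DecidableEq σ]

omit [Fintype σ] [DecidableEq σ] in
/-- The Hessian at a point is the Hessian at the origin of the translate. [folklore] -/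
private theorem hessianMatrix_eq_hess0_transl' (f : MvPolynomial σ ℝ) (x : σ → ℝ) :
    hessianMatrix f x = hess0 (transl x f) := by
  ext s t
  rw [hessianMatrix_apply, hess0_transl]

/-- Eigenvalues of (propositionally) equal symmetric matrices agree. [folklore] -/
private theorem eigenvalues_eq_of_eq {n : Type*} [Fintype n] [DecidableEq n] {A B : Matrix n n ℝ}
    (hA : A.IsHermitian) (hB : B.IsHermitian) (h : A = B) : hA.eigenvalues = hB.eigenvalues := by
  subst h; rfl

omit [Fintype σ] [DecidableEq σ] in
/-- An entry of the Hessian at the origin is a degree-`2` coefficient. [folklore] -/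
private theorem hess0_apply_eq_coeff' (f : MvPolynomial σ ℝ) (s t : σ) :
    hess0 f s t = coeff (Finsupp.single s 1 + Finsupp.single t 1) f *
      (((Finsupp.single s 1 : σ →₀ ℕ) t : ℝ) + 1) := by
  rw [hess0_apply]
  show coeff 0 (pderiv s (pderiv t f)) = _
  rw [coeff_pderiv, zero_add, coeff_pderiv]
  simp

omit [Fintype σ] [DecidableEq σ] in
/-- The Hessian at the origin only sees the quadratic part. [folklore] -/
private theorem hess0_eq_hess0_homogeneousComponent_two' (f : MvPolynomial σ ℝ) :
    hess0 f = hess0 (homogeneousComponent 2 f) := by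
  ext s t
  rw [hess0_apply_eq_coeff', hess0_apply_eq_coeff', coeff_homogeneousComponent, if_pos]
  rw [map_add, Finsupp.degree_single, Finsupp.degree_single]

omit [DecidableEq σ] in
/-- Subadditivity of the rank over a finite sum. [folklore] -/
private theorem rank_finset_sum_le' {ι : Type*} (s : Finset ι) (A : ι → Matrix σ σ ℝ) :
    (∑ i ∈ s, A i).rank ≤ ∑ i ∈ s, (A i).rank := by
  classical
  induction s using Finset.induction_on with
  | empty => simp
  | insert a s ha ih =>
      rw [Finset.sum_insert ha, Finset.sum_insert ha]
      exact (rank_add_le _ _).trans (Nat.add_le_add_left ih _)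

/-- **Glue for Yabe 2015, Thm. 1.7** (§3.1–§3.2, p0008: "`A + Aᵀ = H_{p,x₀}` … by Lemma 3.1 it
follows that `rank(Q_opt) ≥ n₋`. Therefore … `brank(p_{x₀}^{(2)}) ≥ n₋`"): for a real polynomial `p`
and a point `x₀`, the number of negative eigenvalues of the Hessian `H_{p,x₀}` is at most
`brank((p_{x₀})^{(2)})` (and so is the number of positive ones). Proof as printed but WITHOUT
Thm. 2.1: an optimal decomposition `(p_{x₀})^{(2)} = Σ_{i < brank} f_i g_i` into products of linear
forms (`exists_eq_sum_mul_of_isHomogeneous`) gives `H = A + Aᵀ` with `A = Σ_i b_i c_iᵀ` of rank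
`≤ brank` (`hess0_mul_of_isHomogeneous_one`), and Lemma 3.1 (`yabe2015_lemma_3_1_holds`) bounds
`max(n₊, n₋)` of `A + Aᵀ` by `rank A`. Valid for every symmetry proof `hH`.
[cite: Yabe2015, §3.2 (proof of Theorem 1.7)] -/
theorem max_card_eigenvalues_hessian_le_bRank (p : MvPolynomial σ ℝ) (x₀ : σ → ℝ)
    (hH : (hessianMatrix p x₀).IsHermitian) :
    max (Finset.univ.filter fun i => 0 < hH.eigenvalues i).card
        (Finset.univ.filter fun i => hH.eigenvalues i < 0).card ≤
      bRank 1 (homogeneousComponent 2 (transl x₀ p)) := by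
  classical
  set q := homogeneousComponent 2 (transl x₀ p) with hq
  have hqh : q.IsHomogeneous (2 * 1) := by
    simpa using homogeneousComponent_isHomogeneous 2 (transl x₀ p)
  obtain ⟨f, g, hf, hg, hfg⟩ := exists_eq_sum_mul_of_isHomogeneous hqh
  set A : Matrix σ σ ℝ := ∑ i, vecMulVec (linPart (f i)) (linPart (g i)) with hA
  -- `H = A + Aᴴ`
  have hHA : A + Aᴴ = hessianMatrix p x₀ := by
    have hH' : hessianMatrix p x₀ = ∑ i, (vecMulVec (linPart (f i)) (linPart (g i)) +
        vecMulVec (linPart (g i)) (linPart (f i))) := by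
      rw [hessianMatrix_eq_hess0_transl', hess0_eq_hess0_homogeneousComponent_two', ← hq]
      conv_lhs => rw [hfg]
      rw [map_sum]
      exact Finset.sum_congr rfl fun i _ => hess0_mul_of_isHomogeneous_one (hf i) (hg i)
    rw [hH', conjTranspose_eq_transpose_of_trivial, hA, Matrix.transpose_sum, ← Finset.sum_add_distrib]
    exact Finset.sum_congr rfl fun i _ => by rw [transpose_vecMulVec]
  -- `rank A ≤ brank`
  have hrank : A.rank ≤ bRank 1 q := by
    calc A.rank ≤ ∑ i : Fin (bRank 1 q), (vecMulVec (linPart (f i)) (linPart (g i))).rank :=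
          rank_finset_sum_le' _ _
      _ ≤ ∑ _i : Fin (bRank 1 q), 1 := Finset.sum_le_sum fun i _ => rank_vecMulVec_le _ _
      _ = bRank 1 q := by simp
  -- Lemma 3.1 for `Q := A`, transported along `A + Aᴴ = H`
  have h31 := yabe2015_lemma_3_1_holds σ A
  rw [eigenvalues_eq_of_eq (isHermitian_add_transpose_self A) hH hHA] at h31
  exact h31.trans hrank

/-- The negative index of inertia of the real Hessian `H_{p,x₀}` is at most `brank((p_{x₀})^{(2)})`
(Yabe 2015, §3.2, the step "`brank ≥ n₋`" of the proof of Thm. 1.7).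
[cite: Yabe2015, §3.2 (proof of Theorem 1.7)] -/
theorem card_eigenvalues_hessian_neg_le_bRank (p : MvPolynomial σ ℝ) (x₀ : σ → ℝ)
    (hH : (hessianMatrix p x₀).IsHermitian) :
    (Finset.univ.filter fun i => hH.eigenvalues i < 0).card ≤
      bRank 1 (homogeneousComponent 2 (transl x₀ p)) :=
  (le_max_right _ _).trans (max_card_eigenvalues_hessian_le_bRank p x₀ hH)

end Glue

end Yabe

end Literature.Computability.AlgebraicComplexity
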